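import Literature.NumberTheory.EllipticCurves.LocalEulerCharacteristicTorsion
import Literature.NumberTheory.EllipticCurves.ZpExtensionUnramifiedProofs
import Summits.BirchSwinnertonDyer.BirchSwinnertonDyer.Theorems.GenusKolyvaginAtTwoEquivariantKolyvaginExactAtTwoLocalTorsionCount
import HarnessLib

/-!
# Local Tate duality numerics at places prime to the level — unconditional, and at Gross–Kolyvagin primes

Crux `EquivariantKolyvaginExactAtTwo` (Q3, stmt-BirchSwinnertonDyer-24882) of route
`GenusKolyvaginAtTwo`, stub **S3** of the eigen/ℚ architecture (memo `Q3-KERNEL-EIGEN-v2`, §2):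
McCallum 1991, §5 runs on the local numerics at a Kolyvagin prime `λ ∣ ℓ`,
"`E(K_λ)/p^M ≅ (ℤ/p^M)²` with `τ`-eigenspaces `ℤ/p^M`, `H¹(K_λ, E)_{p^M} ≅ (ℤ/p^M)²` dually"
(McCallum, *Kolyvagin's work on Shafarevich–Tate groups*, LMS LN 153 (1991), Lemma 5.3 with §2
Prop. 2.2; Gross 1991, Prop. 6.2 / §8). At `p = 2` the eigenspaces are replaced by the `ℚ_ℓ`-level
groups of `E` and of its twin `E^K` (memo §1); this file supplies the `ℚ_ℓ`-level orders.

## What is here (theorems only; no definition, no named fact)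

For a number field `K`, an elliptic curve `E = W / K`, a finite place `v` and a prime power
`n = p^k` with **`v ∤ p`**:

* `natCard_quotient_span_natCast_eq_one` — `#(𝓞_v / n) = 1` (`n` is a `v`-adic unit).
* `natCard_galoisCohomology_one_torsion_eq_sq_of_not_mem` — **`#H¹(K_v, E[p^k]) = #E(K_v)[p^k]²`**,
  UNCONDITIONALLY: Tate's local Euler–Poincaré characteristic is a theorem of the tree for
  `ℓ`-primary modules with `ℓ ≠` the residue characteristic
  (`PrimeToPEulerChar.natCard_invariants_mul_natCard_two_eq`, Milne I Lemma 2.9: `χ = 1`), with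
  `#H⁰ = #H² = #E(K_v)[n]` (`LocalEulerCharacteristicTorsion`). This discharges the hypothesis
  `hEuler` of `LocalTateDualityOrderForE.lean` off `p`.
* `natCard_torsionBy_localH1_eq_of_not_mem`, `natCard_torsionBy_localH1_eq_card_quotient_of_not_mem`,
  `index_range_nsmul_eq_of_not_mem` — **`#H¹(K_v, E)[p^k] = #E(K_v)[p^k] = #(E(K_v)/p^k E(K_v))`**
  (Milne I Thm. 3.2 / Cor. 3.4 with Lemma 3.3), unconditional off `p`.
* (sequel `…LocalDualityPerfect.lean`: **`𝓛_v^⊥ = 𝓛_v`** for the Weil cup product off `p`,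
  Milne I Cor. 3.4 / Lemma 6.15, Poonen–Rains Prop. 4.10 — kept apart because the cup product needs
  the local instance `absoluteGaloisGroup_compactSpace`.)
* AT GROSS–KOLYVAGIN PRIMES (`K = ℚ`-level of the architecture): for `W/ℚ` globally minimal with
  `Δ < 0`, `ℓ` an odd prime of good reduction with `Frob_ℓ ∼ Frob_∞` on `E[2^{n(ℓ)}]`
  (`FrobEqFrobInfty W K 2 ℓ`, depth `M ≤ n(ℓ) = kolyvaginIndex`), at the place `v ∣ ℓ`:
  **`#H¹(ℚ_ℓ, E[2^M]) = 4^M`**, **`#H¹(ℚ_ℓ, E)[2^M] = 2^M`**, **`[E(ℚ_ℓ) : 2^M E(ℚ_ℓ)] = 2^M`**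
  (`natCard_galoisCohomology_one_two_pow_eq`, `natCard_torsionBy_localH1_two_pow_eq`,
  `index_range_two_pow_eq`) — from `#E(ℚ_ℓ)[2^M] = 2^M`
  (`ReductionCyclic.natCard_ker_zsmul_adicCompletion_two_pow_eq`, p620179/p620824).

BSD is not proved by this file; it is local bookkeeping for the crux's stub S3.

## References

* [MilneADT2006] J. S. Milne, *Arithmetic Duality Theorems*, 2nd ed., Ch. I: Thm. 2.8, Lemma 2.9,
  Thm. 3.2, Lemma 3.3, Cor. 3.4, Lemma 6.15.
* [McCallumLMS1991] W. G. McCallum, *Kolyvagin's work on Shafarevich–Tate groups*, LMS LN 153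
  (1991), §2 Prop. 2.2, §5 Lemma 5.3.
* [GrossLMS1991] B. H. Gross, *Kolyvagin's work on modular elliptic curves*, LMS LN 153 (1991),
  Prop. 6.2, §8.
* [PoonenRains2012] B. Poonen, E. Rains, *Random maximal isotropic subspaces and Selmer groups*,
  JAMS 25 (2012), Prop. 4.10.
-/

noncomputable section

open scoped Classical

universe u

namespace Summit.BirchSwinnertonDyer.BirchSwinnertonDyer.Theorems.GenusExact.LocalDualityOrder

open CategoryTheory Function
open _root_.WeierstrassCurve Field NumberField IsDedekindDomain
open Literature.NumberTheory.EllipticCurves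
open Literature.NumberTheory.GaloisRepresentations
open scoped ContRepresentation

/-! ## Off `p`: `#(𝓞_v/n) = 1` and the Euler characteristic count, unconditionally -/

section OffP

variable {K : Type u} [Field K] [NumberField K] (v : HeightOneSpectrum (𝓞 K))

/-- **`#(𝓞_v / n𝓞_v) = 1` for `v ∤ n`**: `n` is a `v`-adic unit (`‖n‖_v = 1`, tree
`LocalPoints.valuation_natCast_eq_one`, `LocalPoints.isUnit_iff_valuation_eq_one`), so `(n) = 𝓞_v`.
[folklore] -/
theorem natCard_quotient_span_natCast_eq_one {n : ℕ} (hn : (n : 𝓞 K) ∉ v.asIdeal) :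
    Nat.card (v.adicCompletionIntegers K ⧸ Ideal.span {(n : v.adicCompletionIntegers K)}) = 1 := by
  have hu : IsUnit (n : v.adicCompletionIntegers K) := by
    rw [LocalPoints.isUnit_iff_valuation_eq_one v]
    have h := LocalPoints.valuation_natCast_eq_one v hn
    rwa [← SubringClass.coe_natCast (v.adicCompletionIntegers K) n] at h
  rw [Ideal.span_singleton_eq_top.mpr hu]
  haveI : Subsingleton (v.adicCompletionIntegers K ⧸ (⊤ : Ideal (v.adicCompletionIntegers K))) :=
    Ideal.Quotient.subsingleton_iff.mpr rfl
  exact Nat.card_of_subsingleton 0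

omit [NumberField K] in
/-- `v ∤ p ⇒ v ∤ p^k`. [folklore] -/
theorem natCast_pow_notMem {p : ℕ} (hpv : (p : 𝓞 K) ∉ v.asIdeal) (k : ℕ) :
    ((p ^ k : ℕ) : 𝓞 K) ∉ v.asIdeal := by
  intro h
  rw [Nat.cast_pow] at h
  exact hpv (v.isPrime.mem_of_pow_mem k h)

variable (W : WeierstrassCurve K) [W.IsElliptic]

/-- **`#H¹(K_v, E[p^k]) = #E(K_v)[p^k]²` for `v ∤ p`, unconditionally.** Tate's local Euler–Poincaré
characteristic for the `p`-primary module `E[p^k]` at a place of residue characteristic `≠ p` is the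
tree's THEOREM `natCard_invariants_mul_natCard_two_eq` (`#H⁰ · #H² = #H¹`, Milne I Lemma 2.9:
`χ(K_v, M) = 1` for `#M` prime to the residue characteristic), and `#H⁰(K_v, E[n]) = #H²(K_v, E[n]) =
#E(K_v)[n]` (`natCard_invariants_torsion_restrictField`, `natCard_galoisCohomology_two_torsion_restrictField`:
local duality in bidegree `(2,0)` + the Weil pairing). This is the hypothesis `hEuler` of
`LocalTateDualityOrderForE.lean` (there `#(𝓞_v/n) = 1`). [cite: MilneADT2006, Ch. I, Thm. 2.8 and Lemma 2.9]
[cite: MilneADT2006, Ch. I, Cor. 2.3] -/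
theorem natCard_galoisCohomology_one_torsion_eq_sq_of_not_mem {p : ℕ} [Fact p.Prime] {k : ℕ}
    (hk : k ≠ 0) (hpv : (p : 𝓞 K) ∉ v.asIdeal) :
    Nat.card (galoisCohomology
        (GaloisRep.restrictField (v.adicCompletion K) (W.torsionGaloisModule ((p ^ k : ℕ) : ℤ))) 1) =
      Nat.card (nsmulAddMonoidHom (p ^ k) :
          (W.baseChange (v.adicCompletion K)).toAffine.Point →+ _).ker ^ 2 := by
  haveI : CharZero (v.adicCompletion K) := charZero_adicCompletion v
  haveI : NeZero (p ^ k) := ⟨pow_ne_zero _ (Fact.out : p.Prime).ne_zero⟩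
  have hppow : IsPrimePow (p ^ k) := (Fact.out : p.Prime).isPrimePow.pow hk
  haveI : Finite (geomTorsion W ((p ^ k : ℕ) : ℤ)) := finite_geomTorsion_of_neZero W (p ^ k)
  set F := v.adicCompletion K with hF
  set ρ : ContinuousRep (absoluteGaloisGroup F) ℤ (geomTorsion W ((p ^ k : ℕ) : ℤ)) :=
    GaloisRep.restrictField F (W.torsionGaloisModule ((p ^ k : ℕ) : ℤ)) with hρ
  have hA : IsPrimaryTorsion p (geomTorsion W ((p ^ k : ℕ) : ℤ)) :=
    IsPrimaryTorsion.of_forall_nsmul_eq_zero (r := k) fun T => AddSubgroup.torsionBy.nsmul T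
  have hℓ := (v.ringChar_residueField_adicCompletion_ne hpv).symm
  obtain ⟨-, hEq⟩ := natCard_invariants_mul_natCard_two_eq F ρ hA hℓ
  have h0 : Nat.card ρ.toTopRep.ρ.invariants =
      Nat.card (nsmulAddMonoidHom (p ^ k) : (W.baseChange F).toAffine.Point →+ _).ker :=
    natCard_invariants_torsion_restrictField W F (NeZero.ne (p ^ k))
  have h2 : Nat.card (continuousCohomology 2 ρ.toTopRep) =
      Nat.card (nsmulAddMonoidHom (p ^ k) : (W.baseChange F).toAffine.Point →+ _).ker :=
    (natCard_galoisCohomology_two_torsion_restrictField W F (p ^ k) hppow).2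
  change Nat.card (continuousCohomology 1 ρ.toTopRep) = _
  rw [← hEq, h0, h2, sq]

/-- The same count in the shape of the hypothesis `hEuler` of `LocalTateDualityOrderForE.lean`:
`#H¹(K_v, E[p^k]) = (#E(K_v)[p^k] · #(𝓞_v/p^k))²` for `v ∤ p` (the second factor is `1`).
[cite: MilneADT2006, Ch. I, Thm. 2.8 and Lemma 2.9] -/
theorem hEuler_of_not_mem {p : ℕ} [Fact p.Prime] {k : ℕ} (hk : k ≠ 0)
    (hpv : (p : 𝓞 K) ∉ v.asIdeal) :
    Nat.card (galoisCohomology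
        (GaloisRep.restrictField (v.adicCompletion K) (W.torsionGaloisModule ((p ^ k : ℕ) : ℤ))) 1) =
      (Nat.card (nsmulAddMonoidHom (p ^ k) :
            (W.baseChange (v.adicCompletion K)).toAffine.Point →+ _).ker *
          Nat.card (v.adicCompletionIntegers K ⧸
            Ideal.span {((p ^ k : ℕ) : v.adicCompletionIntegers K)})) ^ 2 := by
  rw [natCard_quotient_span_natCast_eq_one v (natCast_pow_notMem v hpv k), mul_one]
  exact natCard_galoisCohomology_one_torsion_eq_sq_of_not_mem v W hk hpv

/-- **Tate local duality for `E` off `p`, order form: `#H¹(K_v, E)[p^k] = #E(K_v)[p^k]`** (`v ∤ p`),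
unconditionally — Milne I Thm. 3.2 / Lemma 3.3 (`H¹(K_v, E)_n ≅ (E(K_v)/n)^*` of order
`#E(K_v)[n] · #(𝓞_v/n)`, the second factor `1` off `p`), via the tree's
`natCard_torsionBy_galoisCohomology_localGaloisModule_eq_of_eulerChar` fed with `hEuler_of_not_mem`.
[cite: MilneADT2006, Ch. I, Thm. 3.2 and Lemma 3.3] -/
theorem natCard_torsionBy_localH1_eq_of_not_mem {p : ℕ} [Fact p.Prime] {k : ℕ} (hk : k ≠ 0)
    (hpv : (p : 𝓞 K) ∉ v.asIdeal) :
    Nat.card (AddSubgroup.torsionBy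
        (galoisCohomology (W.localGaloisModule (v.adicCompletion K)) 1) ((p ^ k : ℕ) : ℤ)) =
      Nat.card (nsmulAddMonoidHom (p ^ k) :
          (W.baseChange (v.adicCompletion K)).toAffine.Point →+ _).ker := by
  haveI : NeZero (p ^ k) := ⟨pow_ne_zero _ (Fact.out : p.Prime).ne_zero⟩
  have h := natCard_torsionBy_galoisCohomology_localGaloisModule_eq_of_eulerChar W v
    (NeZero.ne (p ^ k)) (hEuler_of_not_mem v W hk hpv)
  rwa [natCard_quotient_span_natCast_eq_one v (natCast_pow_notMem v hpv k), mul_one] at h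

/-- **`#H¹(K_v, E)[p^k] = #(E(K_v)/p^k E(K_v))`** off `p`, unconditionally: the order statement of
the perfect pairing `H¹(K_v, E)[n] × E(K_v)/n → ℚ/ℤ` (Milne I Thm. 3.2, Cor. 3.4).
[cite: MilneADT2006, Ch. I, Thm. 3.2 and Cor. 3.4] -/
theorem natCard_torsionBy_localH1_eq_card_quotient_of_not_mem {p : ℕ} [Fact p.Prime] {k : ℕ}
    (hk : k ≠ 0) (hpv : (p : 𝓞 K) ∉ v.asIdeal) :
    Nat.card (AddSubgroup.torsionBy
        (galoisCohomology (W.localGaloisModule (v.adicCompletion K)) 1) ((p ^ k : ℕ) : ℤ)) =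
      Nat.card ((W.baseChange (v.adicCompletion K)).toAffine.Point ⧸
        (nsmulAddMonoidHom (p ^ k) : (W.baseChange (v.adicCompletion K)).toAffine.Point →+ _).range) := by
  haveI : NeZero (p ^ k) := ⟨pow_ne_zero _ (Fact.out : p.Prime).ne_zero⟩
  exact natCard_torsionBy_galoisCohomology_localGaloisModule_eq_card_quotient_of_eulerChar W v
    (NeZero.ne (p ^ k)) (hEuler_of_not_mem v W hk hpv)

/-- **`[E(K_v) : p^k E(K_v)] = #E(K_v)[p^k]` off `p`** (Milne I Lemma 3.3 / Silverman VII.6.3 with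
`#(𝓞_v/p^k) = 1`): tree `card_quotient_range_nsmul_adicCompletion`. [cite: MilneADT2006, I Lemma 3.3]
[cite: SilvermanAEC2009, Prop. VII.6.3] -/
theorem index_range_nsmul_eq_of_not_mem {p : ℕ} [Fact p.Prime] (k : ℕ)
    (hpv : (p : 𝓞 K) ∉ v.asIdeal) :
    (nsmulAddMonoidHom (p ^ k) : (W.baseChange (v.adicCompletion K)).toAffine.Point →+ _).range.index =
      Nat.card (nsmulAddMonoidHom (p ^ k) :
          (W.baseChange (v.adicCompletion K)).toAffine.Point →+ _).ker := by
  rw [AddSubgroup.index, W.card_quotient_range_nsmul_adicCompletion v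
      (pow_ne_zero _ (Fact.out : p.Prime).ne_zero),
    natCard_quotient_span_natCast_eq_one v (natCast_pow_notMem v hpv k), mul_one]

end OffP

/-! ## At Gross–Kolyvagin primes (`K = ℚ`-level, `p = 2`, `Δ < 0`) -/

section GrossKolyvagin

open Summit.BirchSwinnertonDyer.BirchSwinnertonDyer.Theorems.GenusExact.ReductionCyclic

variable (W : WeierstrassCurve ℚ) [W.IsElliptic]

/-- `v ∣ ℓ` with `ℓ` odd ⇒ `v ∤ 2`. [folklore] -/
theorem two_notMem_of_odd_prime_mem {ℓ : ℕ} [Fact ℓ.Prime] (hℓ2 : ℓ ≠ 2)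
    {v : HeightOneSpectrum (𝓞 ℚ)} (hv : (ℓ : 𝓞 ℚ) ∈ v.asIdeal) : ((2 : ℕ) : 𝓞 ℚ) ∉ v.asIdeal := by
  intro h2
  have hℓp : ℓ.Prime := Fact.out
  exact hℓ2 ((primesEquiv_eq_of_natCast_mem hℓp hv).symm.trans
    (primesEquiv_eq_of_natCast_mem Nat.prime_two h2))

/-- **`#H¹(ℚ_ℓ, E[2^M]) = 4^M` at a Gross–Kolyvagin prime of depth `≥ M`** (`W` globally minimal,
`Δ < 0`, `ℓ` odd of good reduction, `Frob_ℓ ∼ Frob_∞` on `E[2^{n(ℓ)}]`, `M ≤ n(ℓ)`): the Euler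
characteristic count `#H¹ = #E(ℚ_ℓ)[2^M]²` off `2` with `#E(ℚ_ℓ)[2^M] = 2^M`
(`ReductionCyclic.natCard_ker_zsmul_adicCompletion_two_pow_eq`). McCallum's
"`H¹(K_λ, E_{p^M}) ≅ (ℤ/p^M)^4`" read at the `ℚ_ℓ`-level. [cite: McCallumLMS1991, §5 Lemma 5.3]
[cite: MilneADT2006, Ch. I, Thm. 2.8] -/
theorem natCard_galoisCohomology_one_two_pow_eq [W.IsGloballyMinimal] (hΔ : W.Δ < 0)
    {K : Type} [Field K] [NumberField K] {ℓ : ℕ} [Fact ℓ.Prime] (hℓ2 : ℓ ≠ 2)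
    (hgoodℓ : W.HasGoodReductionAtPrime ℓ) (hℓ : FrobEqFrobInfty W K 2 ℓ)
    {v : HeightOneSpectrum (𝓞 ℚ)} (hv : (ℓ : 𝓞 ℚ) ∈ v.asIdeal) {M : ℕ} (hM0 : M ≠ 0)
    (hM : M ≤ Zhang2014.kolyvaginIndex W 2 ℓ) :
    Nat.card (galoisCohomology
        (GaloisRep.restrictField (v.adicCompletion ℚ) (W.torsionGaloisModule ((2 ^ M : ℕ) : ℤ))) 1) =
      4 ^ M := by
  haveI : Fact (Nat.Prime 2) := ⟨Nat.prime_two⟩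
  rw [natCard_galoisCohomology_one_torsion_eq_sq_of_not_mem v W hM0 (two_notMem_of_odd_prime_mem hℓ2 hv),
    ← zsmulAddGroupHom_natCast, natCard_ker_zsmul_adicCompletion_two_pow_eq W hΔ hℓ2 hgoodℓ hℓ hv hM,
    ← pow_mul, mul_comm, pow_mul]
  norm_num

/-- **`#H¹(ℚ_ℓ, E)[2^M] = 2^M` at a Gross–Kolyvagin prime of depth `≥ M`**: Tate local duality off
`2` (`natCard_torsionBy_localH1_eq_of_not_mem`) with `#E(ℚ_ℓ)[2^M] = 2^M`. McCallum's
"`H¹(K_λ, E)_{p^M}^{±} ≅ ℤ/p^M`" at the `ℚ_ℓ`-level. [cite: McCallumLMS1991, §5 Lemma 5.3]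
[cite: MilneADT2006, Ch. I, Thm. 3.2] -/
theorem natCard_torsionBy_localH1_two_pow_eq [W.IsGloballyMinimal] (hΔ : W.Δ < 0)
    {K : Type} [Field K] [NumberField K] {ℓ : ℕ} [Fact ℓ.Prime] (hℓ2 : ℓ ≠ 2)
    (hgoodℓ : W.HasGoodReductionAtPrime ℓ) (hℓ : FrobEqFrobInfty W K 2 ℓ)
    {v : HeightOneSpectrum (𝓞 ℚ)} (hv : (ℓ : 𝓞 ℚ) ∈ v.asIdeal) {M : ℕ} (hM0 : M ≠ 0)
    (hM : M ≤ Zhang2014.kolyvaginIndex W 2 ℓ) :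
    Nat.card (AddSubgroup.torsionBy
        (galoisCohomology (W.localGaloisModule (v.adicCompletion ℚ)) 1) ((2 ^ M : ℕ) : ℤ)) =
      2 ^ M := by
  haveI : Fact (Nat.Prime 2) := ⟨Nat.prime_two⟩
  rw [natCard_torsionBy_localH1_eq_of_not_mem v W hM0 (two_notMem_of_odd_prime_mem hℓ2 hv),
    ← zsmulAddGroupHom_natCast]
  exact natCard_ker_zsmul_adicCompletion_two_pow_eq W hΔ hℓ2 hgoodℓ hℓ hv hM

/-- **`[E(ℚ_ℓ) : 2^M E(ℚ_ℓ)] = 2^M` at a Gross–Kolyvagin prime of depth `≥ M`** (Milne I Lemma 3.3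
off `2` with `#E(ℚ_ℓ)[2^M] = 2^M`): McCallum's "`(E(K_λ)/p^M E(K_λ))^{±} ≅ ℤ/p^M`" at the
`ℚ_ℓ`-level — the order of the local Kummer condition `𝓛_ℓ ≅ E(ℚ_ℓ)/2^M`.
[cite: McCallumLMS1991, §5 Lemma 5.3] [cite: MilneADT2006, I Lemma 3.3] -/
theorem index_range_two_pow_eq [W.IsGloballyMinimal] (hΔ : W.Δ < 0)
    {K : Type} [Field K] [NumberField K] {ℓ : ℕ} [Fact ℓ.Prime] (hℓ2 : ℓ ≠ 2)
    (hgoodℓ : W.HasGoodReductionAtPrime ℓ) (hℓ : FrobEqFrobInfty W K 2 ℓ)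
    {v : HeightOneSpectrum (𝓞 ℚ)} (hv : (ℓ : 𝓞 ℚ) ∈ v.asIdeal) {M : ℕ}
    (hM : M ≤ Zhang2014.kolyvaginIndex W 2 ℓ) :
    (nsmulAddMonoidHom (2 ^ M) : (W.baseChange (v.adicCompletion ℚ)).toAffine.Point →+ _).range.index =
      2 ^ M := by
  haveI : Fact (Nat.Prime 2) := ⟨Nat.prime_two⟩
  rw [index_range_nsmul_eq_of_not_mem v W M (two_notMem_of_odd_prime_mem hℓ2 hv),
    ← zsmulAddGroupHom_natCast]
  exact natCard_ker_zsmul_adicCompletion_two_pow_eq W hΔ hℓ2 hgoodℓ hℓ hv hM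

/-- **The order of the local Kummer condition `#𝓛_ℓ = 2^M`** (`𝓛_ℓ = im(E(ℚ_ℓ)/2^M → H¹(ℚ_ℓ, E[2^M]))`,
tree `kummerLocalConditionAt`) at a Gross–Kolyvagin prime of depth `≥ M`: half of
`#H¹(ℚ_ℓ, E[2^M]) = 4^M`, as local Tate duality (`𝓛^⊥ = 𝓛`) demands.
[cite: McCallumLMS1991, §5 Lemma 5.3] [cite: MilneADT2006, I Lemma 3.3 and Cor. 3.4] -/
theorem natCard_kummerLocalConditionAt_two_pow_eq [W.IsGloballyMinimal] (hΔ : W.Δ < 0)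
    {K : Type} [Field K] [NumberField K] {ℓ : ℕ} [Fact ℓ.Prime] (hℓ2 : ℓ ≠ 2)
    (hgoodℓ : W.HasGoodReductionAtPrime ℓ) (hℓ : FrobEqFrobInfty W K 2 ℓ)
    {v : HeightOneSpectrum (𝓞 ℚ)} (hv : (ℓ : 𝓞 ℚ) ∈ v.asIdeal) {M : ℕ}
    (hM : M ≤ Zhang2014.kolyvaginIndex W 2 ℓ) :
    Nat.card (W.kummerLocalConditionAt ((2 ^ M : ℕ) : ℤ) (v.adicCompletion ℚ)) = 2 ^ M := by
  haveI : Fact (Nat.Prime 2) := ⟨Nat.prime_two⟩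
  rw [W.natCard_kummerLocalConditionAt_adicCompletion v (pow_ne_zero M two_ne_zero),
    natCard_quotient_span_natCast_eq_one v
      (natCast_pow_notMem v (two_notMem_of_odd_prime_mem hℓ2 hv) M), mul_one,
    ← zsmulAddGroupHom_natCast]
  exact natCard_ker_zsmul_adicCompletion_two_pow_eq W hΔ hℓ2 hgoodℓ hℓ hv hM

end GrossKolyvagin

end Summit.BirchSwinnertonDyer.BirchSwinnertonDyer.Theorems.GenusExact.LocalDualityOrder

end
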